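/-
Copyright (c) 2026 the pub-hodgecm-mathlib formalisation cell (harness21).  Prover seat hodgecm-mathlib-K2E5-p04 (g0),
Track B «K2-LIT» ∕ h413, engine E5 «TamagawaUnitary», unit G, DEFS LEAF #3m (SWEEP #10e (18) ∕ #11b (21)): `(D_h ⊗ ℝ)^× ≃ₜ* Π_w (D_{h,w})^×`.  2026-09-04.
-/
import Summits.HodgeConjecture.HodgeConjecture.Theorems.K2E5QuatAdelicProdDecomposition   -- ★ #3m ED. 2 (p855902, this seat): `quatArchUnits L Ha ≤ GL₂(mixedSpace L)`, `mem_quatArchUnits_iff`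
import Summits.HodgeConjecture.HodgeConjecture.Theorems.K2E5QuatArchLocalDefs             -- ★ K2E5-p22 (p855948): `quatArchLocal(Units) L Ha w ≤ GL₂(ℂ)` (per complex place)
import Literature.NumberTheory.Automorphic.UnitaryGroupArchimedeanPlaces                 -- ★ `GLnMixedPiEquiv`, `evalC_conjMixed`, `archFormOf_map_evalC`, `mixedSpace_ext`, template `archPiEquiv`
import HarnessLib

/-!
# K2 ∕ E5 — DEFS LEAF #3m: the archimedean unit group place by place, `(D_h ⊗ ℝ)^× ≃ₜ* Π_w (D_{h,w})^×`

★ #3m ED. 2 put the GLOBAL archimedean unit group `quatArchUnits L Ha ≤ GL₂(L ⊗_ℚ ℝ)` (`mixedSpace L = Π_w ℂ` for the CM field `L`, complex places `w`);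
★ K2E5-p22's `K2E5QuatArchLocalDefs` put the PER-PLACE carriers `quatArchLocalUnits L Ha w ≤ GL₂(ℂ)` (the units of `D_{h,w} = {x ∈ M₂(ℂ) : x̄ᵀ h_w = h_w adj x}`,
`h_w = σ_w(h)`) on which the canonical archimedean Haar factors `quatArchCanHaar L Ha w` live (p22's `K2E5QuatArchCanHaarDefs`).  This file is the
`archPiEquiv`-twin the dealer asked for (K2E5-plan (g2), SWEEP #10e (18): «your global `quatArchUnits` maps to `Π_w quatArchLocalUnits` by an `archPiEquiv`-twin;
the arch factor of `quatUnitsProductHaar` := ⊗_w `quatArchCanHaar`»):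

* §1 `map_evalC_mem_quatArchLocalUnits` ∕ `mem_quatArchUnits_iff_forall` — membership in `(D_h ⊗ ℝ)^×` is checked place by place (`c ⊗ 1` is complex conjugation on
  the `w`-coordinate, ★ `evalC_conjMixed`; `(h ⊗ 1)_w = σ_w(h)`, ★ `archFormOf_map_evalC`; `adj` commutes with ring maps);
* §2 `quatArchAt L Ha w : ↥(quatArchUnits L Ha) →* ↥(quatArchLocalUnits L Ha w)` (restriction of `GL₂(evalC w)`; continuous; entries `rfl`);
* §3 **`quatArchPiEquiv L Ha : ↥(quatArchUnits L Ha) ≃ₜ* Π_w ↥(quatArchLocalUnits L Ha w)`** (restriction of ★ `GLnMixedPiEquiv`; verbatim twin of ★ `UnitaryGroup.archPiEquiv`),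
  `quatArchPiEquiv_apply`, `quatArchAt_quatArchPiEquiv_symm`, `coe_quatArchPiEquiv_symm_apply`, `quatArchAt_surjective`.

Consumer: the canonical archimedean factor `quatArchHaar := (quatArchPiEquiv)⁻¹_* ⊗_w quatArchCanHaar` of `quatUnitsProductHaar` (★ #3m ASSEMBLY `K2E5QuatUnitsProductHaar`, ED. 2).
[cite: BorelJacquet1979, §4.1 (G_∞ = Π_{v∣∞} G(F_v))] [cite: PlatonovRapinchuk1994, §5.1] [cite: VignerasLNM800, Ch. III §1 (X_v, v ∣ ∞)]

HONEST LABEL: HC_CM is proved only modulo the 7 printed citations (2 remaining named inputs: hLiu418 = stmt-HodgeConjecture-24832, h413 = stmt-HodgeConjecture-24833)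
until rung 0 closes.  Definitions + structural lemmas only (helper lane, `--supports stmt-HodgeConjecture-24833`); closes no item.  RULES KEPT: no `instance`, no `notation`,
no `sorry`, no `def … : Prop` hypothesis; docstring on every declaration; axioms TRIO.
-/

set_option autoImplicit false
set_option linter.dupNamespace false

noncomputable section

namespace Summit.HodgeConjecture.HodgeConjecture.Cruxes.H413.K2E5QuatArchPlaces

open NumberField NumberField.InfinitePlace NumberField.mixedEmbedding Topology
open Literature.NumberTheory.Automorphic Literature.NumberTheory.Automorphic.UnitaryGroup
open Summit.HodgeConjecture.HodgeConjecture.Cruxes.H413.K2E5QuatAdelicMatrixModel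
open Summit.HodgeConjecture.HodgeConjecture.Cruxes.H413.K2E5QuatAdelicProdDecomposition
open Summit.HodgeConjecture.HodgeConjecture.Cruxes.H413.K2E5QuatArchLocal
open scoped Matrix MatrixGroups

variable (L : Type) [Field L] [NumberField L] [IsCMField L] (Ha : Matrix (Fin 2) (Fin 2) L)

/-! ## §1 Membership in `(D_h ⊗ ℝ)^×` place by place -/

/-- `c ⊗ 1` followed by the `w`-coordinate is complex conjugation of the `w`-coordinate (★ `evalC_conjMixed` in the CM case: `c ≠ 1` fixes every infinite place).
[cite: BorelJacquet1979, §4.1] -/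
theorem evalC_comp_conjMixed (w : {w : InfinitePlace L // IsComplex w}) :
    (⇑(evalC L w) ∘ ⇑(conjMixed (↥(maximalRealSubfield L)) L (IsCMField.complexConj L))) = (⇑(starRingEnd ℂ) ∘ ⇑(evalC L w)) :=
  funext fun x => evalC_conjMixed (↥(maximalRealSubfield L)) L (IsCMField.complexConj L) (complexConj_smul_infinitePlace L w.1) (IsCMField.complexConj_ne_one L) x

/-- The `w`-coordinate of the defining relation: `((c⊗1)g)ᵀ (h⊗1) = (h⊗1) adj g` maps under `evalC w` to `ḡ_wᵀ h_w = h_w adj g_w`. [cite: BorelJacquet1979, §4.1] -/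
theorem map_evalC_rel_iff (w : {w : InfinitePlace L // IsComplex w}) (g : Matrix (Fin 2) (Fin 2) (mixedSpace L)) :
    (((g.map (conjMixed (↥(maximalRealSubfield L)) L (IsCMField.complexConj L)))ᵀ * archFormOf L 2 Ha).map (evalC L w) =
        (archFormOf L 2 Ha * Matrix.adjugate g).map (evalC L w)) ↔
      ((g.map (evalC L w)).map (starRingEnd ℂ))ᵀ * Ha.map w.1.embedding = Ha.map w.1.embedding * Matrix.adjugate (g.map (evalC L w)) := by
  rw [Matrix.map_mul, Matrix.map_mul, Matrix.transpose_map, Matrix.map_map, evalC_comp_conjMixed, ← Matrix.map_map, archFormOf_map_evalC,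
    ← RingHom.mapMatrix_apply (evalC L w) (Matrix.adjugate g), RingHom.map_adjugate, RingHom.mapMatrix_apply]

/-- **`g_w ∈ (D_{h,w})^×` for `g ∈ (D_h ⊗ ℝ)^×`.** [cite: BorelJacquet1979, §4.1] [cite: VignerasLNM800, Ch. III §1] -/
theorem map_evalC_mem_quatArchLocalUnits (w : {w : InfinitePlace L // IsComplex w}) {g : GL (Fin 2) (mixedSpace L)} (hg : g ∈ quatArchUnits L Ha) :
    Matrix.GeneralLinearGroup.map (evalC L w) g ∈ quatArchLocalUnits L Ha w := by
  rw [mem_quatArchLocalUnits_iff, mem_quatArchLocal_iff]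
  rw [mem_quatArchUnits_iff] at hg
  exact (map_evalC_rel_iff L Ha w _).1 (congrArg (fun M : Matrix (Fin 2) (Fin 2) (mixedSpace L) => M.map (evalC L w)) hg)

/-- **Membership in `(D_h ⊗ ℝ)^×` is checked place by place**: `g ∈ (D_h ⊗ ℝ)^× ↔ ∀ w, g_w ∈ (D_{h,w})^×` (no real places: ★ `mixedSpace_ext`). [cite: BorelJacquet1979, §4.1] -/
theorem mem_quatArchUnits_iff_forall (g : GL (Fin 2) (mixedSpace L)) :
    g ∈ quatArchUnits L Ha ↔ ∀ w : {w : InfinitePlace L // IsComplex w}, Matrix.GeneralLinearGroup.map (evalC L w) g ∈ quatArchLocalUnits L Ha w := by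
  refine ⟨fun hg w => map_evalC_mem_quatArchLocalUnits L Ha w hg, fun h => ?_⟩
  rw [mem_quatArchUnits_iff]
  refine Matrix.ext fun i j => mixedSpace_ext (↥(maximalRealSubfield L)) L (IsCMField.complexConj L) (IsCMField.complexConj_ne_one L)
    (complexConj_smul_infinitePlace L) fun w => ?_
  have hw := h w
  rw [mem_quatArchLocalUnits_iff, mem_quatArchLocal_iff] at hw
  have key := (map_evalC_rel_iff L Ha w _).2 hw
  exact (congrFun (congrFun key i) j : _)

/-! ## §2 The `w`-component `(D_h ⊗ ℝ)^× →* (D_{h,w})^×` -/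

/-- **The `w`-component `(D_h ⊗ ℝ)^× →* (D_{h,w})^×`** (restriction of `GL₂(evalC w)`; twin of ★ `archAt`). [cite: BorelJacquet1979, §4.1] -/
def quatArchAt (w : {w : InfinitePlace L // IsComplex w}) : ↥(quatArchUnits L Ha) →* ↥(quatArchLocalUnits L Ha w) :=
  ((Matrix.GeneralLinearGroup.map (evalC L w)).restrict (quatArchUnits L Ha)).codRestrict (quatArchLocalUnits L Ha w)
    fun g => map_evalC_mem_quatArchLocalUnits L Ha w g.2

/-- `quatArchAt w g = GL₂(evalC w) g` on underlying invertible matrices. [folklore] -/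
@[simp] theorem coe_quatArchAt (w : {w : InfinitePlace L // IsComplex w}) (g : ↥(quatArchUnits L Ha)) :
    ((quatArchAt L Ha w g : ↥(quatArchLocalUnits L Ha w)) : GL (Fin 2) ℂ) = Matrix.GeneralLinearGroup.map (evalC L w) (g : GL (Fin 2) (mixedSpace L)) :=
  rfl

/-- Entries of `quatArchAt w g`: the `w`-coordinates of the entries of `g`. [folklore] -/
theorem coe_quatArchAt_apply (w : {w : InfinitePlace L // IsComplex w}) (g : ↥(quatArchUnits L Ha)) (i j : Fin 2) :
    (((quatArchAt L Ha w g : ↥(quatArchLocalUnits L Ha w)) : GL (Fin 2) ℂ) : Matrix (Fin 2) (Fin 2) ℂ) i j =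
      (((g : GL (Fin 2) (mixedSpace L)) : Matrix (Fin 2) (Fin 2) (mixedSpace L)) i j).2 w :=
  rfl

/-- `quatArchAt w` is continuous. [folklore] -/
theorem continuous_quatArchAt (w : {w : InfinitePlace L // IsComplex w}) : Continuous (quatArchAt L Ha w) :=
  (((continuous_evalC L w).generalLinearGroup_map : Continuous (Matrix.GeneralLinearGroup.map (n := Fin 2) (evalC L w))).comp continuous_subtype_val).subtype_mk _

/-! ## §3 `(D_h ⊗ ℝ)^× ≃ₜ* Π_w (D_{h,w})^×` -/

/-- `GL₂(L ⊗ ℝ) ≃ₜ* Π_w GL₂(ℂ)` in the CM case (★ `GLnMixedPiEquiv` at `c` = complex conjugation). [folklore] -/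
def glMixedPiEquiv : GL (Fin 2) (mixedSpace L) ≃ₜ* ({w : InfinitePlace L // IsComplex w} → GL (Fin 2) ℂ) :=
  GLnMixedPiEquiv (↥(maximalRealSubfield L)) L (IsCMField.complexConj L) 2 (IsCMField.complexConj_ne_one L) (complexConj_smul_infinitePlace L)

/-- Components of `glMixedPiEquiv g` are the `GL₂(evalC w) g`. [folklore] -/
@[simp] theorem glMixedPiEquiv_apply (g : GL (Fin 2) (mixedSpace L)) (w : {w : InfinitePlace L // IsComplex w}) :
    glMixedPiEquiv L g w = Matrix.GeneralLinearGroup.map (evalC L w) g :=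
  GLnMixedPiEquiv_apply _ L _ 2 _ _ g w

/-- `GL₂(evalC w) (glMixedPiEquiv.symm u) = u w`. [folklore] -/
@[simp] theorem map_evalC_glMixedPiEquiv_symm (u : {w : InfinitePlace L // IsComplex w} → GL (Fin 2) ℂ) (w : {w : InfinitePlace L // IsComplex w}) :
    Matrix.GeneralLinearGroup.map (evalC L w) ((glMixedPiEquiv L).symm u) = u w :=
  map_evalC_GLnMixedPiEquiv_symm _ L _ 2 _ _ u w

/-- **MAIN DEFINITION. `(D_h ⊗ ℝ)^× ≃ₜ* Π_w (D_{h,w})^×` as topological groups** over the complex places `w` of `L` (restriction of `glMixedPiEquiv` along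
`mem_quatArchUnits_iff_forall`; verbatim twin of ★ `UnitaryGroup.archPiEquiv`). [cite: BorelJacquet1979, §4.1 (G_∞ = Π_{v∣∞} G(F_v))] [cite: PlatonovRapinchuk1994, §5.1] -/
def quatArchPiEquiv : ↥(quatArchUnits L Ha) ≃ₜ* (∀ w : {w : InfinitePlace L // IsComplex w}, ↥(quatArchLocalUnits L Ha w)) where
  toFun g := fun w => quatArchAt L Ha w g
  invFun u := ⟨(glMixedPiEquiv L).symm (fun w => (u w : GL (Fin 2) ℂ)),
    (mem_quatArchUnits_iff_forall L Ha _).2 fun w => by rw [map_evalC_glMixedPiEquiv_symm]; exact (u w).2⟩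
  left_inv g := by
    apply Subtype.ext
    change (glMixedPiEquiv L).symm (fun w => Matrix.GeneralLinearGroup.map (evalC L w) (g : GL (Fin 2) (mixedSpace L))) = _
    have h : (fun w => Matrix.GeneralLinearGroup.map (evalC L w) (g : GL (Fin 2) (mixedSpace L))) = glMixedPiEquiv L (g : GL (Fin 2) (mixedSpace L)) :=
      funext fun w => (glMixedPiEquiv_apply L _ w).symm
    rw [h, ContinuousMulEquiv.symm_apply_apply]
  right_inv u := funext fun w => Subtype.ext (by
    change Matrix.GeneralLinearGroup.map (evalC L w) ((glMixedPiEquiv L).symm fun w => (u w : GL (Fin 2) ℂ)) = _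
    rw [map_evalC_glMixedPiEquiv_symm])
  map_mul' g h := funext fun w => map_mul (quatArchAt L Ha w) g h
  continuous_toFun := continuous_pi fun w => continuous_quatArchAt L Ha w
  continuous_invFun := ((glMixedPiEquiv L).symm.continuous.comp (continuous_pi fun w => continuous_subtype_val.comp (continuous_apply w))).subtype_mk _

/-- `quatArchPiEquiv g w = quatArchAt w g = g_w`. [folklore] -/
@[simp] theorem quatArchPiEquiv_apply (g : ↥(quatArchUnits L Ha)) (w : {w : InfinitePlace L // IsComplex w}) :
    quatArchPiEquiv L Ha g w = quatArchAt L Ha w g := rfl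

/-- `quatArchPiEquiv.symm u` has `w`-component `u w`. [folklore] -/
@[simp] theorem quatArchAt_quatArchPiEquiv_symm (u : ∀ w : {w : InfinitePlace L // IsComplex w}, ↥(quatArchLocalUnits L Ha w)) (w : {w : InfinitePlace L // IsComplex w}) :
    quatArchAt L Ha w ((quatArchPiEquiv L Ha).symm u) = u w := by
  rw [← quatArchPiEquiv_apply L Ha, ContinuousMulEquiv.apply_symm_apply]

/-- On underlying matrices: `quatArchPiEquiv.symm u` has complex coordinates `(u w)_{ij}`. [folklore] -/
theorem coe_quatArchPiEquiv_symm_apply (u : ∀ w : {w : InfinitePlace L // IsComplex w}, ↥(quatArchLocalUnits L Ha w)) (i j : Fin 2) (w : {w : InfinitePlace L // IsComplex w}) :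
    (((((quatArchPiEquiv L Ha).symm u : ↥(quatArchUnits L Ha)) : GL (Fin 2) (mixedSpace L)) : Matrix (Fin 2) (Fin 2) (mixedSpace L)) i j).2 w =
      (((u w : ↥(quatArchLocalUnits L Ha w)) : GL (Fin 2) ℂ) : Matrix (Fin 2) (Fin 2) ℂ) i j :=
  rfl

/-- **Each component `(D_h ⊗ ℝ)^× →* (D_{h,w})^×` is surjective.** [folklore] -/
theorem quatArchAt_surjective (w : {w : InfinitePlace L // IsComplex w}) : Function.Surjective (quatArchAt L Ha w) := fun u => by
  classical
  exact ⟨(quatArchPiEquiv L Ha).symm (Pi.mulSingle w u), by rw [quatArchAt_quatArchPiEquiv_symm, Pi.mulSingle_eq_same]⟩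

end Summit.HodgeConjecture.HodgeConjecture.Cruxes.H413.K2E5QuatArchPlaces

end
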